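import Mathlib
import HarnessLib.Audit
import Summits.PneNP.PneNP.Theorems.PstarFreeFolded
import Summits.PneNP.PneNP.Theorems.PstarGSystemSupport

/-!
# Free folded outputs against a blocked variable set: side systems (pins) and the one-quadratic case (ROUND-24, toward T24.21)

FRONTIER range-avoidance ladder, rung F-N3, ROUND 24 (cell `pnp-ideate`, planner memo `r24/GAPTWO-PLAN.md`; restricted-model proof
complexity — nothing here bears on `P` versus `NP`).

`PstarFreeFolded.card_free_le` bounds the folded outputs whose AND variables avoid the CORE.  The fibre argument only uses that the
base condition ("`z` solves the core") depends on a set `B` of BLOCKED variables disjoint from the free ones.  This file states it in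
that generality — an arbitrary predicate `S` on assignments that only reads `B` (`card_freeB_le`) — and draws two consequences:

* SIDE SYSTEMS: `S z` = "`z` solves the core `J₀` and satisfies a monomial-free side system `P`" (e.g. the unit PINS of the mixed rung
  `PstarGapTwo.MixedPinGap`), `B = nbhd(J₀) ∪ gsupp P` (`solvesSide_congr`): at most `6Δ²` folded outputs of two G-constraints avoid `B`
  (`card_monomials_le_side`), the others number `≤ Δ·|B|` (`card_not_freeB_le`);
* ONE QUADRATIC CONSTRAINT: if a single G-constraint never takes its value on the (non-empty) set `S`, then on any fibre it is CONSTANT,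
  its polar form vanishes and it has NO free monomial at all (`freeB_eq_empty_of_one`, via `const_iso` / `eq_empty_of_iso_top`); so
  `|G| ≤ Δ·|B|` (`card_monomials_le_side_one`).  For the mixed rung (pins `P` + one parity, terminal core `J₀`) this reads
  `#folded ≤ Δ·(4|J₀| + |pinned variables|)` — the killed stars of `PstarMixedPinStar` (`J₀ = ∅`, `|J| = Δ·h`) are exactly this term.
-/

set_option linter.dupNamespace false -- `Summit.PneNP.PneNP.…`: summit = sub-problem name (D-0017 single-conjunct layout)

open Finset Module Literature.Computability.Complexity
open Summit.PneNP.PneNP.Theorems.PstarSALevel (varSet SimpleOverlap)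
open Summit.PneNP.PneNP.Theorems.PstarGapLemma (MaxDegree)
open Summit.PneNP.PneNP.Theorems.PstarGapLinearised (andPair andPair_subset_varSet)
open Summit.PneNP.PneNP.Theorems.PstarGapPeeling (eval_congr)
open Summit.PneNP.PneNP.Theorems.PstarFibrePolys (bit bit_injective bit_add_bit_eq_zero_iff)
open Summit.PneNP.PneNP.Theorems.PstarProductRank (qform polar)
open Summit.PneNP.PneNP.Theorems.PstarGraphQuadGap (Edge Simple EdgeMaxDegree)
open Summit.PneNP.PneNP.Theorems.PstarGapOneAll (gval)
open Summit.PneNP.PneNP.Theorems.PstarGConstraint (bit_gval)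
open Summit.PneNP.PneNP.Theorems.PstarGSystemSupport (csupp gsupp mem_csupp mem_gsupp)
open Summit.PneNP.PneNP.Theorems.PstarGraphQuadGapTwoForms (const_iso)
open Summit.PneNP.PneNP.Theorems.PstarFreeFoldedForms (two_forms_fibres eq_empty_of_iso_top)
open Summit.PneNP.PneNP.Theorems.PstarFreeFoldedFibre

namespace Summit.PneNP.PneNP.Theorems.PstarFreeFoldedSide

variable {n m : ℕ}

/-! ## Freeness against a blocked set -/

/-- An output is FREE AGAINST `B` when both its AND variables lie outside `B`. -/
def FreeB (I : LocalMap 4 n m) (B : Finset (Fin n)) (g : Fin m) : Prop := I.vars g 2 ∉ B ∧ I.vars g 3 ∉ B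

/-- `gval` only reads the support of the constraint. -/
theorem gval_congr (I : LocalMap 4 n m) (w : Finset (Fin n) × Finset (Fin m) × Bool) {z z' : Fin n → Bool}
    (h : ∀ v ∈ csupp I w, z' v = z v) : gval I w.1 w.2.1 z' = gval I w.1 w.2.1 z := by
  apply bit_injective
  rw [bit_gval, bit_gval]
  congr 1
  · exact sum_congr rfl fun v hv => by rw [h v (mem_csupp.2 (Or.inl hv))]
  · refine sum_congr rfl fun g hg => ?_
    rw [h _ (mem_csupp.2 (Or.inr ⟨g, hg, by simp [PstarGapLinearised.andPair]⟩)),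
      h _ (mem_csupp.2 (Or.inr ⟨g, hg, by simp [PstarGapLinearised.andPair]⟩))]

section Blocked

variable (I : LocalMap 4 n m) (hI : I.IsPure xorAndPred) (hS : SimpleOverlap I) {Δ : ℕ} (hD : MaxDegree Δ I)
  (B : Finset (Fin n)) (S : (Fin n → Bool) → Prop) (hSB : ∀ z z' : Fin n → Bool, (∀ v ∈ B, z' v = z v) → S z → S z')
  (C₁ C₂ : Finset (Fin n)) (G₁ G₂ : Finset (Fin m)) (b₁ b₂ : Bool)

include hD in
/-- Outputs that are not free against `B` read a variable of `B` at an AND slot: at most `Δ·|B|` of them. -/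
theorem card_not_freeB_le [DecidablePred (FreeB I B)] (G : Finset (Fin m)) :
    (G.filter fun g => ¬ FreeB I B g).card ≤ Δ * B.card := by
  classical
  have hsub : (G.filter fun g => ¬ FreeB I B g) ⊆ B.biUnion fun v => (univ : Finset (Fin m)).filter fun g => v ∈ varSet I g := by
    intro g hg
    obtain ⟨-, hnf⟩ := mem_filter.1 hg
    unfold FreeB at hnf
    rw [mem_biUnion]
    by_cases h2 : I.vars g 2 ∈ B
    · exact ⟨I.vars g 2, h2, mem_filter.2 ⟨mem_univ _, mem_image.2 ⟨2, mem_univ _, rfl⟩⟩⟩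
    · have h3 : I.vars g 3 ∈ B := by by_contra h3; exact hnf ⟨h2, h3⟩
      exact ⟨I.vars g 3, h3, mem_filter.2 ⟨mem_univ _, mem_image.2 ⟨3, mem_univ _, rfl⟩⟩⟩
  calc (G.filter fun g => ¬ FreeB I B g).card ≤ (B.biUnion fun v => (univ : Finset (Fin m)).filter fun g => v ∈ varSet I g).card :=
        card_le_card hsub
    _ ≤ ∑ v ∈ B, ((univ : Finset (Fin m)).filter fun g => v ∈ varSet I g).card := card_biUnion_le
    _ ≤ ∑ _v ∈ B, Δ := sum_le_sum fun v _ => hD v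
    _ = Δ * B.card := by rw [sum_const, smul_eq_mul, mul_comm]

include hI hS hD hSB in
/-- **At most `6Δ²` monomial outputs of two G-constraints are free against `B`**, if the two constraints are never simultaneously satisfied
on `S` (a condition reading only `B`) and every free monomial output has a flip witness in `S`. -/
theorem card_freeB_le [DecidablePred (FreeB I B)]
    (hinf : ¬ ∃ z : Fin n → Bool, S z ∧ gval I C₁ G₁ z = b₁ ∧ gval I C₂ G₂ z = b₂)
    (hM : ∀ g ∈ G₁ ∪ G₂, FreeB I B g → ∃ z : Fin n → Bool, S z ∧
      (gval I C₁ G₁ z = b₁ ↔ g ∉ G₁) ∧ (gval I C₂ G₂ z = b₂ ↔ g ∉ G₂)) :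
    ((G₁ ∪ G₂).filter (FreeB I B)).card ≤ 6 * Δ ^ 2 := by
  classical
  -- the free variables: outside `B`
  set U : Finset (Fin n) := ((G₁ ∪ G₂).filter (FreeB I B)).biUnion (andPair I) with hUdef
  have hUB : ∀ v ∈ U, v ∉ B := by
    intro v hv
    rw [hUdef, mem_biUnion] at hv
    obtain ⟨g, hg, hvg⟩ := hv
    have hfree := (mem_filter.1 hg).2
    unfold PstarGapLinearised.andPair at hvg
    rw [mem_insert, mem_singleton] at hvg
    rcases hvg with rfl | rfl
    exacts [hfree.1, hfree.2]
  have hFU : ∀ g ∈ G₁ ∪ G₂, FreeB I B g → FreeU U I g := fun g hg hf =>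
    ⟨mem_biUnion.2 ⟨g, mem_filter.2 ⟨hg, hf⟩, by simp [PstarGapLinearised.andPair]⟩,
      mem_biUnion.2 ⟨g, mem_filter.2 ⟨hg, hf⟩, by simp [PstarGapLinearised.andPair]⟩⟩
  have hUF : ∀ g, FreeU U I g → FreeB I B g := fun g hg => ⟨hUB _ hg.1, hUB _ hg.2⟩
  have hle : ((G₁ ∪ G₂).filter (FreeB I B)).card ≤ ((G₁ ∪ G₂).filter (FreeU U I)).card :=
    card_le_card fun g hg => mem_filter.2 ⟨(mem_filter.1 hg).1, hFU g (mem_filter.1 hg).1 (mem_filter.1 hg).2⟩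
  refine hle.trans ?_
  have hTU : TU U I G₁ ∪ TU U I G₂ = TU U I (G₁ ∪ G₂) := by unfold TU; rw [filter_union, image_union]
  rw [card_filter_free_eq U I hI hS, ← hTU]
  -- the fibre family over `S`
  let Z := {z : Fin n → Bool // S z}
  let f₁ : Z → (Fin (U.card + 1) → ZMod 2) → ZMod 2 := fun ζ x => bit (gval I C₁ G₁ (ext U ζ.1 x)) + bit b₁
  let f₂ : Z → (Fin (U.card + 1) → ZMod 2) → ZMod 2 := fun ζ x => bit (gval I C₂ G₂ (ext U ζ.1 x)) + bit b₂
  have hsol : ∀ (ζ : Z) (x : Fin (U.card + 1) → ZMod 2), S (ext U ζ.1 x) :=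
    fun ζ x => hSB ζ.1 _ (fun v hv => ext_of_not_mem U ζ.1 x fun hvU => hUB v hvU hv) ζ.2
  have hf₁0 : ∀ (ζ : Z) x, f₁ ζ x = 0 ↔ gval I C₁ G₁ (ext U ζ.1 x) = b₁ := fun ζ x => bit_add_bit_eq_zero_iff _ _
  have hf₂0 : ∀ (ζ : Z) x, f₂ ζ x = 0 ↔ gval I C₂ G₂ (ext U ζ.1 x) = b₂ := fun ζ x => bit_add_bit_eq_zero_iff _ _
  refine two_forms_fibres (E := TU U I G₁ ∪ TU U I G₂) (T₁ := TU U I G₁) (T₂ := TU U I G₂) (f₁ := f₁) (f₂ := f₂)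
    (L₁ := fun ζ => linG U I ζ.1 C₁ G₁) (L₂ := fun ζ => linG U I ζ.1 C₂ G₂)
    (c₁ := fun ζ => constG U I ζ.1 C₁ G₁ + bit b₁) (c₂ := fun ζ => constG U I ζ.1 C₂ G₂ + bit b₂)
    (by rw [hTU]; exact simple_TU U I hI _) (by rw [hTU]; exact edgeMaxDegree_TU U I hD _)
    subset_union_left subset_union_right ?_ ?_ ?_ ?_
  · intro ζ x
    show bit (gval I C₁ G₁ (ext U ζ.1 x)) + bit b₁ = _
    rw [bit_gval_ext, sum_coordU_mul U I hI hS]; ring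
  · intro ζ x
    show bit (gval I C₂ G₂ (ext U ζ.1 x)) + bit b₂ = _
    rw [bit_gval_ext, sum_coordU_mul U I hI hS]; ring
  · intro ζ x
    by_contra h
    push Not at h
    exact hinf ⟨ext U ζ.1 x, hsol ζ x, (hf₁0 ζ x).1 h.1, (hf₂0 ζ x).1 h.2⟩
  · intro t ht
    have ht' : t ∈ TU U I (G₁ ∪ G₂) := by rw [← hTU]; exact ht
    unfold TU at ht'
    obtain ⟨g, hg, rfl⟩ := mem_image.1 ht'
    obtain ⟨hgG, hfree⟩ := mem_filter.1 hg
    obtain ⟨z, hzS, hz1, hz2⟩ := hM g hgG (hUF g hfree)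
    refine ⟨⟨z, hzS⟩, restr U z, ?_, ?_⟩
    · rw [hf₁0, edgeU_mem_TU_iff U I hI hS hfree]
      show gval I C₁ G₁ (ext U z (restr U z)) = b₁ ↔ g ∉ G₁
      rw [ext_restr]; exact hz1
    · rw [hf₂0, edgeU_mem_TU_iff U I hI hS hfree]
      show gval I C₂ G₂ (ext U z (restr U z)) = b₂ ↔ g ∉ G₂
      rw [ext_restr]; exact hz2

include hI hS hD hSB in
/-- **One quadratic constraint has no free monomial.**  If a single G-constraint never takes its value on the non-empty set `S`, then
no monomial output of it is free against `B`: on a fibre it is constant, so its polar form vanishes. -/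
theorem freeB_eq_empty_of_one [DecidablePred (FreeB I B)] (C : Finset (Fin n)) (G : Finset (Fin m)) (b : Bool)
    (hZ : ∃ z : Fin n → Bool, S z) (hinf : ¬ ∃ z : Fin n → Bool, S z ∧ gval I C G z = b) :
    G.filter (FreeB I B) = ∅ := by
  classical
  obtain ⟨z, hz⟩ := hZ
  set U : Finset (Fin n) := (G.filter (FreeB I B)).biUnion (andPair I) with hUdef
  have hUB : ∀ v ∈ U, v ∉ B := by
    intro v hv
    rw [hUdef, mem_biUnion] at hv
    obtain ⟨g, hg, hvg⟩ := hv
    have hfree := (mem_filter.1 hg).2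
    unfold PstarGapLinearised.andPair at hvg
    rw [mem_insert, mem_singleton] at hvg
    rcases hvg with rfl | rfl
    exacts [hfree.1, hfree.2]
  have hFU : ∀ g ∈ G, FreeB I B g → FreeU U I g := fun g hg hf =>
    ⟨mem_biUnion.2 ⟨g, mem_filter.2 ⟨hg, hf⟩, by simp [PstarGapLinearised.andPair]⟩,
      mem_biUnion.2 ⟨g, mem_filter.2 ⟨hg, hf⟩, by simp [PstarGapLinearised.andPair]⟩⟩
  -- the constraint on the fibre of `z`
  set f : (Fin (U.card + 1) → ZMod 2) → ZMod 2 := fun x => bit (gval I C G (ext U z x)) + bit b with hfdef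
  have hf : ∀ x, f x = qform (TU U I G) Prod.fst Prod.snd x + linG U I z C G x + (constG U I z C G + bit b) := by
    intro x; rw [hfdef]; dsimp only; rw [bit_gval_ext, sum_coordU_mul U I hI hS]; ring
  have hone : ∀ x, f x = 1 := by
    intro x
    have hne : f x ≠ 0 := fun h0 =>
      hinf ⟨ext U z x, hSB z _ (fun v hv => ext_of_not_mem U z x fun hvU => hUB v hvU hv) hz, (bit_add_bit_eq_zero_iff _ _).1 h0⟩
    revert hne; generalize f x = t; revert t; decide
  have hconst : ∀ u ∈ (⊤ : Submodule (ZMod 2) (Fin (U.card + 1) → ZMod 2)), f (0 + u) = f 0 := fun u _ => by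
    rw [hone, hone]
  have hiso := const_iso (T := TU U I G) ⊤ f (linG U I z C G) (constG U I z C G + bit b) hf 0 hconst
  have hT : TU U I G = ∅ := eq_empty_of_iso_top (E := TU U I G) (simple_TU U I hI G) (edgeMaxDegree_TU U I hD G) subset_rfl hiso
  -- no free edge, hence no free output
  have hcard := card_filter_free_eq U I hI hS G
  rw [hT, card_empty, card_eq_zero, filter_eq_empty_iff] at hcard
  exact filter_eq_empty_iff.2 fun g hg hf => hcard hg (hFU g hg hf)

include hI hS hD hSB in
/-- **Two constraints**: all monomial outputs number at most `6Δ² + Δ·|B|`. -/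
theorem card_le_of_two [DecidablePred (FreeB I B)]
    (hinf : ¬ ∃ z : Fin n → Bool, S z ∧ gval I C₁ G₁ z = b₁ ∧ gval I C₂ G₂ z = b₂)
    (hM : ∀ g ∈ G₁ ∪ G₂, FreeB I B g → ∃ z : Fin n → Bool, S z ∧
      (gval I C₁ G₁ z = b₁ ↔ g ∉ G₁) ∧ (gval I C₂ G₂ z = b₂ ↔ g ∉ G₂)) :
    (G₁ ∪ G₂).card ≤ 6 * Δ ^ 2 + Δ * B.card := by
  classical
  rw [← Finset.card_filter_add_card_filter_not (FreeB I B)]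
  exact Nat.add_le_add (card_freeB_le I hI hS hD B S hSB C₁ C₂ G₁ G₂ b₁ b₂ hinf hM) (card_not_freeB_le I hD B _)

include hI hS hD hSB in
/-- **One constraint**: all monomial outputs number at most `Δ·|B|`. -/
theorem card_le_of_one [DecidablePred (FreeB I B)] (C : Finset (Fin n)) (G : Finset (Fin m)) (b : Bool)
    (hZ : ∃ z : Fin n → Bool, S z) (hinf : ¬ ∃ z : Fin n → Bool, S z ∧ gval I C G z = b) : G.card ≤ Δ * B.card := by
  classical
  rw [← Finset.card_filter_add_card_filter_not (FreeB I B), freeB_eq_empty_of_one I hI hS hD B S hSB C G b hZ hinf, card_empty,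
    zero_add]
  exact card_not_freeB_le I hD B _

end Blocked

/-! ## Core plus a monomial-free side system -/

section Side

variable (I : LocalMap 4 n m) (hI : I.IsPure xorAndPred) (hS : SimpleOverlap I) {Δ : ℕ} (hD : MaxDegree Δ I)
  (y : Fin m → Bool) (J₀ : Finset (Fin m)) (P : Finset (Finset (Fin n) × Finset (Fin m) × Bool))

/-- The blocked set of a core and a side system: the variables of the core outputs and the support of the side system. -/
def blocked : Finset (Fin n) := J₀.biUnion (varSet I) ∪ gsupp I P

/-- "`z` solves the core and satisfies the side system" only reads the blocked set. -/
theorem solvesSide_congr {z z' : Fin n → Bool} (h : ∀ v ∈ blocked I J₀ P, z' v = z v)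
    (hz : (∀ j ∈ J₀, I.eval z j = y j) ∧ ∀ w ∈ P, gval I w.1 w.2.1 z = w.2.2) :
    (∀ j ∈ J₀, I.eval z' j = y j) ∧ ∀ w ∈ P, gval I w.1 w.2.1 z' = w.2.2 := by
  refine ⟨fun j hj => ?_, fun w hw => ?_⟩
  · rw [← hz.1 j hj]
    exact eval_congr I j fun s => h _ (mem_union_left _ (mem_biUnion.2 ⟨j, hj, mem_image.2 ⟨s, mem_univ _, rfl⟩⟩))
  · rw [← hz.2 w hw]
    exact gval_congr I w fun v hv => h v (mem_union_right _ (mem_gsupp.2 ⟨w, hw, hv⟩))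

/-- The blocked set is small: `≤ 4|J₀| + |gsupp P|`. -/
theorem card_blocked_le : (blocked I J₀ P).card ≤ 4 * J₀.card + (gsupp I P).card := by
  unfold blocked
  refine (card_union_le _ _).trans (Nat.add_le_add_right ?_ _)
  refine card_biUnion_le.trans ?_
  calc ∑ j ∈ J₀, (varSet I j).card ≤ ∑ _j ∈ J₀, 4 := sum_le_sum fun j _ => by
          unfold PstarSALevel.varSet; exact card_image_le.trans (by simp)
    _ = 4 * J₀.card := by rw [sum_const, smul_eq_mul, mul_comm]

include hI hS hD in
/-- **Core + monomial-free side system, two G-constraints**: `#(G₁ ∪ G₂) ≤ 6Δ² + Δ·(4|J₀| + |gsupp P|)`. -/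
theorem card_monomials_le_side (C₁ C₂ : Finset (Fin n)) (G₁ G₂ : Finset (Fin m)) (b₁ b₂ : Bool)
    (hinf : ¬ ∃ z : Fin n → Bool, ((∀ j ∈ J₀, I.eval z j = y j) ∧ ∀ w ∈ P, gval I w.1 w.2.1 z = w.2.2) ∧
      gval I C₁ G₁ z = b₁ ∧ gval I C₂ G₂ z = b₂)
    (hM : ∀ g ∈ G₁ ∪ G₂, ∃ z : Fin n → Bool, ((∀ j ∈ J₀, I.eval z j = y j) ∧ ∀ w ∈ P, gval I w.1 w.2.1 z = w.2.2) ∧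
      (gval I C₁ G₁ z = b₁ ↔ g ∉ G₁) ∧ (gval I C₂ G₂ z = b₂ ↔ g ∉ G₂)) :
    (G₁ ∪ G₂).card ≤ 6 * Δ ^ 2 + Δ * (4 * J₀.card + (gsupp I P).card) := by
  classical
  have h := card_le_of_two I hI hS hD (blocked I J₀ P) _ (fun z z' hzz' hz => solvesSide_congr I y J₀ P hzz' hz)
    C₁ C₂ G₁ G₂ b₁ b₂ hinf (fun g hg _ => hM g hg)
  exact h.trans (Nat.add_le_add_left (Nat.mul_le_mul_left Δ (card_blocked_le I J₀ P)) _)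

include hI hS hD in
/-- **Core + monomial-free side system, ONE G-constraint** (the shape of the mixed rung: pins + one parity): if the core and the side
system are jointly satisfiable but never together with the constraint, then `#G ≤ Δ·(4|J₀| + |gsupp P|)` — no free monomial survives. -/
theorem card_monomials_le_side_one (C : Finset (Fin n)) (G : Finset (Fin m)) (b : Bool)
    (hZ : ∃ z : Fin n → Bool, (∀ j ∈ J₀, I.eval z j = y j) ∧ ∀ w ∈ P, gval I w.1 w.2.1 z = w.2.2)
    (hinf : ¬ ∃ z : Fin n → Bool, ((∀ j ∈ J₀, I.eval z j = y j) ∧ ∀ w ∈ P, gval I w.1 w.2.1 z = w.2.2) ∧ gval I C G z = b) :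
    G.card ≤ Δ * (4 * J₀.card + (gsupp I P).card) := by
  classical
  have h := card_le_of_one I hI hS hD (blocked I J₀ P) _ (fun z z' hzz' hz => solvesSide_congr I y J₀ P hzz' hz) C G b hZ hinf
  exact h.trans (Nat.mul_le_mul_left Δ (card_blocked_le I J₀ P))

end Side

end Summit.PneNP.PneNP.Theorems.PstarFreeFoldedSide
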